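import Mathlib
import HarnessLib

/-!
# A quantitative Lindemann–Weierstrass theorem: Ably's measure of algebraic independence (1994)

Family `periods` / summit `Schanuel`, layer `Literature/NumberTheory/Transcendental`, in the pattern
of the sibling named fact `NesterenkoWaldschmidt1996_thm_2_2` (`PiTranscendenceMeasure.lean`).

Source READ (held, `paper:doi-10-4064-aa-67-1-29-45`, pp. 29–30 of the journal = text pages 1–2):
M. Ably, *Une version quantitative du théorème de Lindemann–Weierstrass*, Acta Arith. 67 (1994)
29–45 [Ably1994]. Théorème (p. 30), verbatim: "Soient `y₁, …, yₙ` des nombres algébriques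
`ℚ`-linéairement indépendants et `K = ℚ(y₁, …, yₙ)`. Alors, il existe `C = C(y₁, …, yₙ) > 0` tel que
pour tout polynôme `P ∈ ℤ[X₁, …, Xₙ]` non nul, de degré `≤ D` et de hauteur naïve `≤ H`, on ait
`log |P(e^{y₁}, …, e^{yₙ})| ≥ −c₂ Dⁿ (log H + exp(C Dⁿ log(D + 1)))` où
`c₂ = 2^{n(4n²+18n+25)+4} n^{n²+n+2} (4[K:ℚ]+n+1)^{n+2} ([K:ℚ])^{n²+n+1}`. En particulier, si
l'inégalité `log log H > C Dⁿ log(D+1)` est vérifiée, alors on a `Φ(e^{y₁}, …, e^{yₙ}, D, H) ≥ H^{−2c₂Dⁿ}`."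
(p. 29: "la hauteur naïve d'un polynôme de `ℤ[X₁, …, Xₙ]` étant le maximum des valeurs absolues de ses
coefficients"; degree = total degree; `Φ(…, H, D) = min |P(…)|` over non-zero `P` of total degree `≤ D`
and naive height `≤ H`.) Context quoted there: Mahler 1932 (`Φ ≥ H^{−cDⁿ}` for `H ≥ H₀(D, y)`),
Nesterenko 1977 (the same above `log log H > C D^{2n} log(D+1)`, explicit `c₁`).

## Rendering

* `y : Fin n → ℂ` with every `y i` algebraic over `ℚ` and `LinearIndependent ℚ y`;
  `P : MvPolynomial (Fin n) ℤ`, `P ≠ 0`, `P.totalDegree ≤ D`, all coefficients `|P.coeff m| ≤ H`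
  (naive height `≤ H`); the value `P(e^{y₁}, …, e^{yₙ})` is `MvPolynomial.aeval (fun i ↦ exp (y i)) P`.
* The inequality is stated in the exponentiated form
  `exp(−c₂ Dⁿ (log H + exp(C Dⁿ log(D+1)))) ≤ |P(e^y)|` (equivalent to the printed `log |P| ≥ −…`
  and, like it, containing the non-vanishing `P(e^y) ≠ 0`, i.e. Lindemann–Weierstrass itself).
* The constant `c₂` is rendered EXISTENTIALLY (`∃ c₂ > 0` depending on `n` and `y`), which is weaker
  than print (print gives the explicit value above, depending only on `n` and `[K:ℚ]`); `C = C(y) > 0`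
  is existential in print as well. Nothing more than print is claimed. Degenerate instances are
  harmless: for `n = 0` a non-zero constant `P ∈ ℤ` has `|P| ≥ 1 ≥ exp(−…)`; `H = 0` forces `P = 0`.

## What this grounds

The Lindemann–Weierstrass layer (`s ∈ ℚ̄ⁿ`, the "LW points") of the cruxes `KhovanskiiApproxType`
(item 6116) / `KhovanskiiApproxTypeEv` (item 14972) of the route `Schanuel/DiophantineDichotomy`
("THEOREM-GRADE modulo vendoring one printed theorem: Ably1994 Thm p.30", route text; stub
`stub_lwPenaltyMeasure` of its line `height-window-compactness`). Users take
`(h : Ably1994_lindemannWeierstrass_measure)`.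

## Not here

The proof (Jabbouri's criterion for algebraic independence + Siegel–Shidlovskii on E-functions);
the explicit `c₂`; the corollary above `log log H > C Dⁿ log(D+1)` (immediate from the theorem).
-/

namespace Literature.NumberTheory.Transcendental

/-- **Ably 1994, Théorème (Acta Arith. 67, p. 30) — a measure of algebraic independence of
`e^{y₁}, …, e^{yₙ}` for `ℚ`-linearly independent algebraic `y₁, …, yₙ`:** there is `C = C(y) > 0`
(and the printed explicit `c₂ = c₂(n, [ℚ(y):ℚ]) > 0`, rendered here existentially) such that for
every non-zero `P ∈ ℤ[X₁, …, Xₙ]` of total degree `≤ D` and naive height `≤ H`,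
`log |P(e^{y₁}, …, e^{yₙ})| ≥ −c₂ Dⁿ (log H + exp(C Dⁿ log(D+1)))`; stated as
`exp(−c₂ Dⁿ (log H + exp(C Dⁿ log(D+1)))) ≤ ‖P(e^{y₁}, …, e^{yₙ})‖`.
[cite: Ably1994, Théorème p. 30] -/
def Ably1994_lindemannWeierstrass_measure : Prop :=
  ∀ (n : ℕ) (y : Fin n → ℂ), (∀ i, IsAlgebraic ℚ (y i)) → LinearIndependent ℚ y →
    ∃ C c₂ : ℝ, 0 < C ∧ 0 < c₂ ∧
      ∀ (P : MvPolynomial (Fin n) ℤ) (D H : ℕ), P ≠ 0 → P.totalDegree ≤ D →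
        (∀ m, |P.coeff m| ≤ (H : ℤ)) →
          Real.exp (-(c₂ * (D : ℝ) ^ n *
              (Real.log H + Real.exp (C * (D : ℝ) ^ n * Real.log ((D : ℝ) + 1))))) ≤
            ‖MvPolynomial.aeval (fun i => Complex.exp (y i)) P‖

/-- Sanity of the hypotheses on the degenerate height: if all coefficients of `P` are bounded by
`H = 0` in absolute value then `P = 0`, so the fact never speaks about `H = 0`. [folklore] -/
theorem eq_zero_of_coeff_abs_le_zero {n : ℕ} (P : MvPolynomial (Fin n) ℤ)
    (h : ∀ m, |P.coeff m| ≤ ((0 : ℕ) : ℤ)) : P = 0 := by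
  ext m
  have := h m
  simp only [Nat.cast_zero, abs_nonpos_iff] at this
  simpa using this

end Literature.NumberTheory.Transcendental
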